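import Mathlib
import Literature.Geometry.Lorentzian.NearKerrLeaf
import Literature.Geometry.Lorentzian.BoundedGeometry
import HarnessLib

/-!
# Tolerance thresholds of the `Cᵏ` deviation: `‖η‖_op = 1`, and `deviationCk ≤ ‖Ψ^* g‖_{Cᵏ} + 1` on the
hyperboloidal flat background

Sanity API for the route-posited closeness vocabulary `Spacetime.deviationCk` (`KerrConvergence`) and the flat
background `hypBackground` of `IsNearKerrLeaf` (`NearKerrLeaf`), recorded as negative knowledge for every
consumer that quantifies over a LARGE tolerance (`∀ Λ < ⊤`, `∃ Λ < ⊤`):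

* `Minkowski.norm_bilin_eq_one` — the Minkowski form `η(v, w) = −v⁰w⁰ + ∑ vⁱwⁱ` has operator norm EXACTLY `1`
  on `E4 = EuclideanSpace ℝ (Fin 4)` (the upper bound is `Minkowski.norm_bilin_le_one` of `BoundedGeometry`; the
  value is attained at `v = w = e₁`), so the threshold below is sharp;
* `iteratedFDeriv_sub_const_of_ne_zero` — `Dᵐ(f − c) = Dᵐ f` for `m ≠ 0`, with NO differentiability
  hypothesis (Mathlib's `fderiv_sub_const`, iterated);
* `supCkENorm_sub_const_le` — `‖f − c‖_{Cᵏ(S)} ≤ ‖f‖_{Cᵏ(S)} + ‖c‖`;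
* `deviationCk_hypBackground_top_le` — for the hyperboloidal flat background on all of `E4` and ANY chart map
  `Ψ₀`, `deviationCk (hypBackground ⊤) Ψ₀ k τ ≤ supCkENorm (slab) k (Ψ₀^* g) + 1`: a chart whose pulled-back
  metric is `Cᵏ`-small (a "collapsed" chart `Ψ₀ = E ∘ (λ · θ)`, `λ → 0`) has deviation at most `1 + o(1)`, so a
  closeness clause `deviationCk … ≤ Λ` with `Λ > 1` certifies nothing about the metric
  (`deviationCk_hypBackground_top_le_of_le`). The missing normalisation is exactly the pair of cone clauses of
  `Spacetime.HasBoundedGeometryOn` (`BoundedGeometry`), which `IsNearKerrLeaf` does not carry.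

Nothing here has a printed source beyond linear algebra and calculus ([folklore] throughout); the form `η` is
O'Neill 1983, Ch. 3, p. 55, read through the Euclidean structure of `ℝ⁴`.

Addendum (same day): the converse side of the threshold, section `BelowThreshold` —
`enorm_deviation_le_deviationCk` / `norm_deviation_le_of_deviationCk_le` (order-zero extraction on the slab),
`abs_pullback_sub_minkowski_le` (`|g(dΨ₀ v, dΨ₀ w) − η(v, w)| ≤ Λ ‖v‖ ‖w‖`), and the two cone clauses of
`Spacetime.HasBoundedGeometryOn` with constant `(1 − Λ)⁻¹` when `deviationCk ≤ Λ < 1`: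
`pullback_basisVector_zero_le` (`g(dΨ₀ ∂₀, dΨ₀ ∂₀) ≤ Λ − 1`) and `le_pullback_of_apply_zero_eq_zero`
(`g(dΨ₀ v, dΨ₀ v) ≥ (1 − Λ)‖v‖²` for `v⁰ = 0`). So the flat-chart clause of `IsNearKerrLeaf` is honest exactly for
tolerances `Λ < 1 = ‖η‖_op`.
-/

noncomputable section

open Set Filter Topology TopologicalSpace
open scoped Manifold ContDiff Topology ENNReal BigOperators

namespace Literature.Geometry.Lorentzian

/-! ### The operator norm of the Minkowski form -/

/-- `‖η‖_op = 1` on `E4 →L[ℝ] E4 →L[ℝ] ℝ`: the bound `Minkowski.norm_bilin_le_one` is attained at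
`v = w = e₁` (O'Neill 1983, Ch. 3, p. 55, through the Euclidean structure of `ℝ⁴`). [folklore] -/
theorem Minkowski.norm_bilin_eq_one : ‖Minkowski.bilin‖ = 1 := by
  refine le_antisymm Minkowski.norm_bilin_le_one ?_
  -- evaluate at the unit spatial vector e₁
  set e : E4 := EuclideanSpace.single (1 : Fin 4) (1 : ℝ) with he
  have hne : ‖e‖ = 1 := by rw [he, EuclideanSpace.single, PiLp.norm_single, norm_one]
  have hval : Minkowski.bilin e e = 1 := by
    rw [Minkowski.bilin_apply, he]
    simp [Fin.sum_univ_three]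
  have h := (Minkowski.bilin e).le_opNorm e
  rw [hval, hne, Real.norm_eq_abs, abs_one, mul_one] at h
  have h' := Minkowski.bilin.le_opNorm e
  rw [hne, mul_one] at h'
  exact h.trans h'

/-! ### `Cᵏ` sup norms of `f − c` -/

section SubConst

variable {F G : Type*} [NormedAddCommGroup F] [NormedSpace ℝ F] [NormedAddCommGroup G]
  [NormedSpace ℝ G]

/-- `Dᵐ(f − c) = Dᵐ f` for every `m ≠ 0`, without any differentiability hypothesis (iterate Mathlib's
`fderiv_sub_const`). [folklore] -/
theorem iteratedFDeriv_sub_const_of_ne_zero (f : F → G) (c : G) :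
    ∀ {m : ℕ}, m ≠ 0 → iteratedFDeriv ℝ m (fun x => f x - c) = iteratedFDeriv ℝ m f := by
  intro m hm
  induction m with
  | zero => exact absurd rfl hm
  | succ m ih =>
    rw [iteratedFDeriv_succ_eq_comp_left, iteratedFDeriv_succ_eq_comp_left]
    congr 1
    rcases Nat.eq_zero_or_pos m with rfl | hpos
    · -- m = 0: `D⁰(f − c) = L ∘ (f − c)` differs from `L ∘ f` by a constant
      funext x
      rw [iteratedFDeriv_zero_eq_comp, iteratedFDeriv_zero_eq_comp]
      have : ((continuousMultilinearCurryFin0 ℝ F G).symm ∘ fun x => f x - c) =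
          fun x => ((continuousMultilinearCurryFin0 ℝ F G).symm ∘ f) x -
            (continuousMultilinearCurryFin0 ℝ F G).symm c := by
        funext y
        simp only [Function.comp_apply, map_sub]
      rw [this, fderiv_sub_const]
    · rw [ih (Nat.pos_iff_ne_zero.1 hpos)]

/-- `‖f − c‖_{Cᵏ(S)} ≤ ‖f‖_{Cᵏ(S)} + ‖c‖`: subtracting a constant changes only the order-`0` term of the `Cᵏ`
sup norm. [folklore] -/
theorem supCkENorm_sub_const_le (S : Set F) (k : ℕ) (f : F → G) (c : G) :
    supCkENorm S k (fun x => f x - c) ≤ supCkENorm S k f + ‖c‖ₑ := by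
  refine iSup₂_le fun m hm => iSup₂_le fun x hx => ?_
  rcases Nat.eq_zero_or_pos m with rfl | hpos
  · -- order 0: ‖f x − c‖ ≤ ‖f x‖ + ‖c‖
    have h0 : ‖iteratedFDeriv ℝ 0 (fun x => f x - c) x‖ₑ = ‖f x - c‖ₑ := by
      rw [← ofReal_norm, norm_iteratedFDeriv_zero, ofReal_norm]
    have h0' : ‖iteratedFDeriv ℝ 0 f x‖ₑ = ‖f x‖ₑ := by
      rw [← ofReal_norm, norm_iteratedFDeriv_zero, ofReal_norm]
    rw [h0]
    calc ‖f x - c‖ₑ ≤ ‖f x‖ₑ + ‖c‖ₑ := enorm_sub_le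
      _ = ‖iteratedFDeriv ℝ 0 f x‖ₑ + ‖c‖ₑ := by rw [h0']
      _ ≤ supCkENorm S k f + ‖c‖ₑ := by
          gcongr
          exact enorm_iteratedFDeriv_le_supCkENorm hm hx f
  · rw [iteratedFDeriv_sub_const_of_ne_zero f c (Nat.pos_iff_ne_zero.1 hpos)]
    exact (enorm_iteratedFDeriv_le_supCkENorm hm hx f).trans le_self_add

end SubConst

/-! ### The deviation on the hyperboloidal flat background is at most `‖Ψ₀^* g‖_{Cᵏ} + 1` -/

universe u

namespace Spacetime

variable (𝓢 : Spacetime.{u} 4)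

/-- On `hypBackground ⊤` the zero-extended deviation is `Ψ₀^* g − η` everywhere (the domain of
`hypBackground ⊤` is all of `E4`, so the extension by zero never fires). [folklore] -/
theorem deviationExtend_hypBackground_top (Ψ₀ : (hypBackground (⊤ : Opens E4)).domain → 𝓢.carrier) :
    𝓢.deviationExtend (hypBackground ⊤) Ψ₀ = fun y =>
      (show E4 →L[ℝ] E4 →L[ℝ] ℝ from
        pullbackBilin (I := 𝓡 4) (I' := 𝓘(ℝ, E4)) Ψ₀ 𝓢.metric.val ⟨y, trivial⟩) - Minkowski.bilin := by
  funext y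
  have hy : y = ((⟨y, trivial⟩ : (hypBackground (⊤ : Opens E4)).domain) : E4) := rfl
  conv_lhs => rw [hy]
  rw [deviationExtend_coe]
  rfl

/-- **Tolerance threshold of the flat-chart clause.** For the hyperboloidal flat background on all of `E4`
and ANY map `Ψ₀`, the `Cᵏ` deviation on the slab `{t₀ = τ}` is at most the `Cᵏ` sup norm of the pulled-back
metric `Ψ₀^* g` there plus `‖η‖_op = 1`:
`deviationCk (hypBackground ⊤) Ψ₀ k τ ≤ supCkENorm {t₀ = τ} k (Ψ₀^* g) + 1`. Consequently a closeness
clause `deviationCk … ≤ Λ` with `Λ > 1` is met by every chart whose pulled-back metric is `Cᵏ`-small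
(collapsed charts) and certifies nothing about `g`. [folklore] -/
theorem deviationCk_hypBackground_top_le (Ψ₀ : (hypBackground (⊤ : Opens E4)).domain → 𝓢.carrier)
    (k : ℕ) (τ : ℝ) :
    𝓢.deviationCk (hypBackground ⊤) Ψ₀ k τ ≤
      supCkENorm (Subtype.val '' (hypBackground (⊤ : Opens E4)).timeSlab τ) k (fun y : E4 =>
        (show E4 →L[ℝ] E4 →L[ℝ] ℝ from
          pullbackBilin (I := 𝓡 4) (I' := 𝓘(ℝ, E4)) Ψ₀ 𝓢.metric.val ⟨y, trivial⟩)) + 1 := by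
  rw [deviationCk, deviationExtend_hypBackground_top]
  refine (supCkENorm_sub_const_le _ k _ _).trans ?_
  gcongr
  rw [← ofReal_norm, Minkowski.norm_bilin_eq_one, ENNReal.ofReal_one]

/-- Corollary: if `‖Ψ₀^* g‖_{Cᵏ(slab)} ≤ θ` and `1 + θ ≤ Λ`, the flat-chart closeness clause of `IsNearKerrLeaf`
holds with tolerance `Λ` — whatever the metric `g` is. [folklore] -/
theorem deviationCk_hypBackground_top_le_of_le (Ψ₀ : (hypBackground (⊤ : Opens E4)).domain → 𝓢.carrier)
    (k : ℕ) (τ : ℝ) {θ Λ : ℝ≥0∞}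
    (hθ : supCkENorm (Subtype.val '' (hypBackground (⊤ : Opens E4)).timeSlab τ) k (fun y : E4 =>
        (show E4 →L[ℝ] E4 →L[ℝ] ℝ from
          pullbackBilin (I := 𝓡 4) (I' := 𝓘(ℝ, E4)) Ψ₀ 𝓢.metric.val ⟨y, trivial⟩)) ≤ θ)
    (hΛ : 1 + θ ≤ Λ) : 𝓢.deviationCk (hypBackground ⊤) Ψ₀ k τ ≤ Λ :=
  ((𝓢.deviationCk_hypBackground_top_le Ψ₀ k τ).trans (by rw [add_comm]; gcongr)).trans hΛ

/-! ### Below the threshold: `deviationCk ≤ Λ < 1` forces non-degeneracy (the cone clauses) -/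

section BelowThreshold

variable (B : ModelBackground)

/-- Order-zero extraction: at a point of the slab `{t = τ}`, `‖(Ψ^* g − g₀)(x)‖ₑ ≤ deviationCk B Ψ k τ`.
[folklore] -/
theorem enorm_deviation_le_deviationCk (Ψ : B.domain → 𝓢.carrier) (k : ℕ) {τ : ℝ} {x : B.domain}
    (hx : x ∈ B.timeSlab τ) : ‖𝓢.deviation B Ψ x‖ₑ ≤ 𝓢.deviationCk B Ψ k τ := by
  have h := enorm_iteratedFDeriv_le_supCkENorm (Nat.zero_le k) (Set.mem_image_of_mem Subtype.val hx)
    (𝓢.deviationExtend B Ψ)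
  rw [← ofReal_norm, norm_iteratedFDeriv_zero, deviationExtend_coe] at h
  rw [← ofReal_norm]
  exact h

/-- Real-valued form: if `deviationCk B Ψ k τ ≤ Λ` (`0 ≤ Λ`), then `‖(Ψ^* g − g₀)(x)‖ ≤ Λ` on the slab. [folklore] -/
theorem norm_deviation_le_of_deviationCk_le (Ψ : B.domain → 𝓢.carrier) (k : ℕ) {τ Λ : ℝ} (hΛ : 0 ≤ Λ)
    (h : 𝓢.deviationCk B Ψ k τ ≤ ENNReal.ofReal Λ) {x : B.domain} (hx : x ∈ B.timeSlab τ) :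
    ‖𝓢.deviation B Ψ x‖ ≤ Λ := by
  have h' := (𝓢.enorm_deviation_le_deviationCk B Ψ k hx).trans h
  rwa [← ofReal_norm, ENNReal.ofReal_le_ofReal_iff hΛ] at h'

variable (U₀ : Opens E4)

/-- On the hyperboloidal flat background, `deviationCk ≤ Λ` bounds the pulled-back metric against `η` pointwise on
the slab: `|g(dΨ₀ v, dΨ₀ w) − η(v, w)| ≤ Λ ‖v‖ ‖w‖`. [folklore] -/
theorem abs_pullback_sub_minkowski_le (Ψ₀ : (hypBackground U₀).domain → 𝓢.carrier) (k : ℕ) {τ Λ : ℝ}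
    (hΛ : 0 ≤ Λ) (h : 𝓢.deviationCk (hypBackground U₀) Ψ₀ k τ ≤ ENNReal.ofReal Λ)
    {x : (hypBackground U₀).domain} (hx : x ∈ (hypBackground U₀).timeSlab τ) (v w : E4) :
    |𝓢.metric.val (Ψ₀ x) (mfderiv 𝓘(ℝ, E4) (𝓡 4) Ψ₀ x v) (mfderiv 𝓘(ℝ, E4) (𝓡 4) Ψ₀ x w) -
        Minkowski.bilin v w| ≤ Λ * ‖v‖ * ‖w‖ := by
  have hdev := 𝓢.norm_deviation_le_of_deviationCk_le (hypBackground U₀) Ψ₀ k hΛ h hx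
  have happ : 𝓢.deviation (hypBackground U₀) Ψ₀ x v w =
      𝓢.metric.val (Ψ₀ x) (mfderiv 𝓘(ℝ, E4) (𝓡 4) Ψ₀ x v) (mfderiv 𝓘(ℝ, E4) (𝓡 4) Ψ₀ x w) -
        Minkowski.bilin v w := by
    rw [deviation_apply, hypBackground_bilin]
  rw [← happ, ← Real.norm_eq_abs]
  calc ‖𝓢.deviation (hypBackground U₀) Ψ₀ x v w‖
      ≤ ‖𝓢.deviation (hypBackground U₀) Ψ₀ x v‖ * ‖w‖ := ContinuousLinearMap.le_opNorm _ _
    _ ≤ ‖𝓢.deviation (hypBackground U₀) Ψ₀ x‖ * ‖v‖ * ‖w‖ := by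
        gcongr; exact ContinuousLinearMap.le_opNorm _ _
    _ ≤ Λ * ‖v‖ * ‖w‖ := by gcongr

/-- **Below the threshold the coordinate time is honestly timelike.** If `deviationCk ≤ Λ` with `Λ < 1` on the
hyperboloidal flat background, then `g(dΨ₀ ∂₀, dΨ₀ ∂₀) ≤ Λ − 1 < 0` on the slab: the first cone clause of
`Spacetime.HasBoundedGeometryOn` with constant `(1 − Λ)⁻¹`; in particular `dΨ₀` does not collapse `∂₀`. [folklore] -/
theorem pullback_basisVector_zero_le (Ψ₀ : (hypBackground U₀).domain → 𝓢.carrier) (k : ℕ) {τ Λ : ℝ}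
    (hΛ : 0 ≤ Λ) (h : 𝓢.deviationCk (hypBackground U₀) Ψ₀ k τ ≤ ENNReal.ofReal Λ)
    {x : (hypBackground U₀).domain} (hx : x ∈ (hypBackground U₀).timeSlab τ) :
    𝓢.metric.val (Ψ₀ x) (mfderiv 𝓘(ℝ, E4) (𝓡 4) Ψ₀ x (E4.basisVector 0))
        (mfderiv 𝓘(ℝ, E4) (𝓡 4) Ψ₀ x (E4.basisVector 0)) ≤ Λ - 1 := by
  have h1 := 𝓢.abs_pullback_sub_minkowski_le U₀ Ψ₀ k hΛ h hx (E4.basisVector 0) (E4.basisVector 0)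
  have hn : ‖E4.basisVector 0‖ = 1 := by
    rw [E4.basisVector, EuclideanSpace.single, PiLp.norm_single, norm_one]
  rw [Minkowski.bilin_basisVector_zero, hn, mul_one, mul_one] at h1
  linarith [(abs_le.1 h1).2]

/-- **Below the threshold the coordinate slices are honestly spacelike.** If `deviationCk ≤ Λ` with `Λ < 1` on the
hyperboloidal flat background, then `g(dΨ₀ v, dΨ₀ v) ≥ (1 − Λ) ‖v‖²` for every `v` with `v⁰ = 0` on the slab: the second
cone clause of `Spacetime.HasBoundedGeometryOn` with constant `(1 − Λ)⁻¹`. Together with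
`deviationCk_hypBackground_top_le` this locates the threshold of the flat-chart clause of `IsNearKerrLeaf` exactly at
`Λ = ‖η‖_op = 1`: honest (quasi-isometric) charts below, collapsed charts admitted above. [folklore] -/
theorem le_pullback_of_apply_zero_eq_zero (Ψ₀ : (hypBackground U₀).domain → 𝓢.carrier) (k : ℕ) {τ Λ : ℝ}
    (hΛ : 0 ≤ Λ) (h : 𝓢.deviationCk (hypBackground U₀) Ψ₀ k τ ≤ ENNReal.ofReal Λ)
    {x : (hypBackground U₀).domain} (hx : x ∈ (hypBackground U₀).timeSlab τ) {v : E4} (hv : v 0 = 0) :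
    (1 - Λ) * ‖v‖ ^ 2 ≤
      𝓢.metric.val (Ψ₀ x) (mfderiv 𝓘(ℝ, E4) (𝓡 4) Ψ₀ x v) (mfderiv 𝓘(ℝ, E4) (𝓡 4) Ψ₀ x v) := by
  have h1 := 𝓢.abs_pullback_sub_minkowski_le U₀ Ψ₀ k hΛ h hx v v
  have hη : Minkowski.bilin v v = ‖v‖ ^ 2 := by
    rw [Minkowski.bilin_apply, EuclideanSpace.real_norm_sq_eq, Fin.sum_univ_succ (f := fun i => v i ^ 2), hv]
    simp [sq]
  rw [hη] at h1
  nlinarith [(abs_le.1 h1).1, sq_nonneg ‖v‖]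

end BelowThreshold

end Spacetime

end Literature.Geometry.Lorentzian

end
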